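import Summits.QuantumFields.GaugeBoot.TiltedFrameNoGo
import Summits.QuantumFields.GaugeBoot.TiltedBoxSiteRP
import HarnessLib

/-!
# Which periodic boxes `ℤ^d / Γ` carry a site frame: classification
# (gauge-boot, L3 structural supplement, part 1 of 2)

HONEST FRAMING (cell `pub-gaugeboot`, page 1 of every file): the venture produces certified bounds
on lattice expectations at stated coupling, gauge group, dimension and torus size; NOT a mass gap,
NOT a continuum limit, NOT a string tension; NOT Yang–Mills-summit-bearing (barriers
`FixedCouplingUltralocality`, `PerturbativeInvisibility`). This module is a small STRUCTURAL result
about the lane's reflection mechanisms; it bounds no expectation and discharges nothing else.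

The EXISTENCE side of `TiltedFrameNoGo.lean`, site frames first (tilted diagonal frames:
`PeriodicBoxTiltedFrames.lean`). A **periodic box** is a quotient `ℤ^d / Γ` of the free lattice
`ℤ^d = (Fin d → ℤ)` by a subgroup `Γ` of periods, with marked translations
`PeriodicBox.unit Γ m = [e_m]` (the classes of the unit vectors; they generate the box,
`closure_range_unit`, and an additive map out of the box is determined by its values on them,
`addMonoidHom_ext`). The tree's volumes are of this form: the 45°-tilted box
`TiltedSite d i j M_u M_v L = ℤ^d / Γ(M_u, M_v, L)` (`TiltedBox.lean`; `unit_tiltedLattice`), the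
cubic torus `(ℤ/L)^d ≅ ℤ^d / Lℤ^d`, Kazakov–Zheng's periodic boxes.

**Theorem (`PeriodicBox.exists_isSiteFrame_iff`).** `ℤ^d / Γ` carries a site frame along the axis
`k` with half period `Q` (`IsSiteFrame`, `TiltedSiteRPGeometry.lean`: the structure behind SITE
reflection positivity in `x_k = 0` and LINK reflection positivity in `x_k = ½` — Kazakov–Zheng's
first two families) if and only if `Q ≥ 2`, `2Q e_k ∈ Γ` and `Γ ⊆ {x : 2Q ∣ x_k}` — i.e.
`Γ = (Γ ∩ {x_k = 0}) ⊕ ℤ · 2Q e_k`: the axis `k` is an HONEST periodic direction of EVEN period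
`2Q ≥ 4`, all other periods lying in the hyperplane `x_k = 0`. The frame is then unique and explicit
(`IsSiteFrame.eq_reflect_coord`): the reflection `[x] ↦ [x_k ↦ -x_k]` (`PeriodicBox.reflect`) and
the coordinate `[x] ↦ x_k mod 2Q` (`PeriodicBox.coord`). Instances: the cubic torus of even side
along every axis, the tilted box along `k ∉ {i, j}` with `L = 2Q` (`isSiteFrame_tiltedBox`); never
along an in-plane axis of a tilted box (`TiltedFrameNoGo.lean`), never on a torus of odd side.

Necessity is the torsion arithmetic of `TiltedFrameNoGo.lean` (`2Q • e_k = 0`) plus the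
identification of the height with the coordinate (`siteHeight_mk`, by `addMonoidHom_ext`);
sufficiency is the Fröhlich–Israel–Lieb–Simon computation `x - (x_k ↦ -x_k) x = 2x_k e_k`
(`negHom_eq_sub`), a multiple of the period `2Q e_k` on the layers `x_k ≡ 0, Q`.

What this module does NOT say: it is about FRAMES (the lane's sufficient structures for reflection
positivity on a finite periodic volume), not about reflection positivity itself (RP-level failures:
`TiltedBoxAxisRPNegative.lean`, `TiltedBoxRedSiteRPNegativeUniform.lean`; RP without a frame in
`d = 2`: `TiltedBoxEvenAxisRPTwoDim.lean`).

References: J. Fröhlich, R. Israel, E. H. Lieb, B. Simon, Comm. Math. Phys. 62 (1978) 1, Thm. 2.1;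
K. Osterwalder, E. Seiler, Ann. Phys. 110 (1978) 440, §2; S. Friedli, Y. Velenik, Statistical
Mechanics of Lattice Systems (2017) §10.3.1 (reflections of the torus `𝕋_L`, `L` even, through
vertices and through edges); J. Glimm, A. Jaffe, Quantum Physics (2nd ed.) Thm. 7.10.2;
V. Kazakov, Z. Zheng, arXiv:2203.11360 §3.1.
-/

open QuotientAddGroup

namespace Summit.QuantumFields.GaugeBoot

namespace TiltedRP

/-! ## A coordinate identity on `ℤ^d` -/

section Coordinates

variable (d : ℕ)

/-- `(x_k ↦ -x_k) x = x - 2 x_k e_k`. -/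
theorem negHom_eq_sub (k : Fin d) (x : Fin d → ℤ) :
    negHom d k x = x - (2 * x k) • (Pi.single k (1 : ℤ) : Fin d → ℤ) := by
  funext m
  simp only [negHom_apply, Pi.sub_apply, Pi.smul_apply, smul_eq_mul]
  by_cases hm : m = k
  · subst hm
    rw [if_pos rfl, Pi.single_eq_same]
    ring
  · rw [if_neg hm, Pi.single_eq_of_ne hm]
    ring


end Coordinates

/-! ## Periodic boxes `ℤ^d / Γ` and their marked translations -/

namespace PeriodicBox

variable {d : ℕ} (Γ : AddSubgroup (Fin d → ℤ))

/-- **The marked translations of the periodic box `ℤ^d / Γ`**: the classes `[e_m]` of the unit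
vectors. -/
def unit (m : Fin d) : (Fin d → ℤ) ⧸ Γ := ((Pi.single m (1 : ℤ) : Fin d → ℤ) : (Fin d → ℤ) ⧸ Γ)

/-- `unit Γ m = [e_m]`. -/
theorem unit_eq (m : Fin d) :
    unit Γ m = ((Pi.single m (1 : ℤ) : Fin d → ℤ) : (Fin d → ℤ) ⧸ Γ) := rfl

/-- The tilted box of `TiltedBox.lean` is the periodic box of the tilted lattice, with the same
marked translations. -/
theorem unit_tiltedLattice (i j : Fin d) (Mu Mv L : ℕ) :
    unit (tiltedLattice d i j Mu Mv L) = tiltedUnit d i j Mu Mv L := rfl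

/-- The class of `x ∈ ℤ^d` is `∑_m x_m [e_m]`. -/
theorem mk_eq_sum_zsmul_unit (x : Fin d → ℤ) :
    (x : (Fin d → ℤ) ⧸ Γ) = ∑ m, x m • unit Γ m := by
  conv_lhs => rw [← Finset.univ_sum_single x]
  rw [← QuotientAddGroup.mk'_apply, map_sum]
  refine Finset.sum_congr rfl fun m _ => ?_
  rw [QuotientAddGroup.mk'_apply, unit, ← QuotientAddGroup.mk_zsmul, ← Pi.single_smul', smul_eq_mul,
    mul_one]

/-- **The marked translations generate the box.** (So the uniqueness statements of
`TiltedFrameRigidity.lean` apply to every periodic box.) -/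
theorem closure_range_unit : AddSubgroup.closure (Set.range (unit Γ)) = ⊤ := by
  rw [eq_top_iff]
  rintro q -
  induction q using QuotientAddGroup.induction_on with
  | H x =>
    rw [mk_eq_sum_zsmul_unit]
    exact AddSubgroup.sum_mem _ fun m _ =>
      AddSubgroup.zsmul_mem _ (AddSubgroup.subset_closure (Set.mem_range_self m)) _

/-- **An additive map out of a periodic box is determined by its values on the marked
translations.** -/
theorem addMonoidHom_ext {M : Type*} [AddCommMonoid M] {f g : (Fin d → ℤ) ⧸ Γ →+ M}
    (hfg : ∀ m, f (unit Γ m) = g (unit Γ m)) : f = g :=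
  QuotientAddGroup.addMonoidHom_ext _ (AddMonoidHom.functions_ext' _ _ _ fun m =>
    AddMonoidHom.ext_int (by simpa [unit] using hfg m))

/-! ## Site frames on a periodic box -/

section Site

variable {Γ} {k : Fin d} {Q : ℕ}

/-- **The height of a site frame on a periodic box is the coordinate**: `h [x] = x_k mod 2Q`. -/
theorem siteHeight_mk {σ : (Fin d → ℤ) ⧸ Γ →+ (Fin d → ℤ) ⧸ Γ} {h : (Fin d → ℤ) ⧸ Γ →+ ZMod (2 * Q)}
    (hS : IsSiteFrame (unit Γ) k σ Q h) (x : Fin d → ℤ) :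
    h (x : (Fin d → ℤ) ⧸ Γ) = ((x k : ℤ) : ZMod (2 * Q)) := by
  have key : h.comp (QuotientAddGroup.mk' Γ) =
      (Int.castAddHom (ZMod (2 * Q))).comp (Pi.evalAddMonoidHom (fun _ : Fin d => ℤ) k) := by
    refine AddMonoidHom.functions_ext' _ _ _ fun m => AddMonoidHom.ext_int ?_
    simp only [AddMonoidHom.coe_comp, Function.comp_apply, AddMonoidHom.single_apply,
      QuotientAddGroup.mk'_apply, Pi.evalAddMonoidHom_apply, Int.coe_castAddHom]
    by_cases hm : m = k
    · subst hm
      rw [Pi.single_eq_same, Int.cast_one]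
      exact hS.height_self
    · rw [Pi.single_eq_of_ne (Ne.symm hm), Int.cast_zero]
      exact hS.height_other m hm
  exact DFunLike.congr_fun key x

/-- Necessity, first half: **every period has `k`-th coordinate divisible by `2Q`.** -/
theorem dvd_coord_of_isSiteFrame {σ : (Fin d → ℤ) ⧸ Γ →+ (Fin d → ℤ) ⧸ Γ}
    {h : (Fin d → ℤ) ⧸ Γ →+ ZMod (2 * Q)} (hS : IsSiteFrame (unit Γ) k σ Q h) {γ : Fin d → ℤ}
    (hγ : γ ∈ Γ) : ((2 * Q : ℕ) : ℤ) ∣ γ k := by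
  have h0 : h (γ : (Fin d → ℤ) ⧸ Γ) = 0 := by
    rw [(QuotientAddGroup.eq_zero_iff γ).2 hγ, map_zero]
  rw [siteHeight_mk hS] at h0
  exact (ZMod.intCast_zmod_eq_zero_iff_dvd _ _).1 h0

/-- Necessity, second half: **`2Q e_k` is a period.** -/
theorem nsmul_single_mem_of_isSiteFrame {σ : (Fin d → ℤ) ⧸ Γ →+ (Fin d → ℤ) ⧸ Γ}
    {h : (Fin d → ℤ) ⧸ Γ →+ ZMod (2 * Q)} (hS : IsSiteFrame (unit Γ) k σ Q h) :
    (2 * Q) • (Pi.single k (1 : ℤ) : Fin d → ℤ) ∈ Γ := by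
  rw [← QuotientAddGroup.eq_zero_iff, QuotientAddGroup.mk_nsmul]
  exact hS.two_mul_nsmul_e_self

/-- Multiples `(n c) • s` of a period `n • s` are periods. -/
theorem mul_zsmul_mem {s : Fin d → ℤ} {n : ℕ} (hs : n • s ∈ Γ) (c : ℤ) : ((n : ℤ) * c) • s ∈ Γ := by
  rw [mul_comm, mul_smul, natCast_zsmul]
  exact Γ.zsmul_mem hs c

/-- Sufficiency, step 1: under the two conditions `Γ` is invariant under `x_k ↦ -x_k`
(`γ - (x_k ↦ -x_k) γ = 2γ_k e_k`, a multiple of the period `2Q e_k`). -/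
theorem le_comap_negHom (hmem : (2 * Q) • (Pi.single k (1 : ℤ) : Fin d → ℤ) ∈ Γ)
    (hdiv : ∀ γ ∈ Γ, ((2 * Q : ℕ) : ℤ) ∣ γ k) : Γ ≤ Γ.comap (negHom d k) := by
  intro γ hγ
  rw [AddSubgroup.mem_comap, negHom_eq_sub]
  obtain ⟨c, hc⟩ := hdiv γ hγ
  refine Γ.sub_mem hγ ?_
  rw [hc, show 2 * (((2 * Q : ℕ) : ℤ) * c) = ((2 * Q : ℕ) : ℤ) * (2 * c) by ring]
  exact mul_zsmul_mem hmem _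

/-- **The site reflection of the box along `k`**: `[x] ↦ [x_k ↦ -x_k]` (defined when `Γ` is
invariant). -/
def reflect (hΓ : Γ ≤ Γ.comap (negHom d k)) : (Fin d → ℤ) ⧸ Γ →+ (Fin d → ℤ) ⧸ Γ :=
  QuotientAddGroup.map Γ Γ (negHom d k) hΓ

/-- **The coordinate `[x] ↦ x_k mod 2Q` of the box** (defined when `Γ ⊆ {2Q ∣ x_k}`). -/
def coord (Q : ℕ) (hdiv : ∀ γ ∈ Γ, ((2 * Q : ℕ) : ℤ) ∣ γ k) : (Fin d → ℤ) ⧸ Γ →+ ZMod (2 * Q) :=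
  QuotientAddGroup.lift Γ
    ((Int.castAddHom (ZMod (2 * Q))).comp (Pi.evalAddMonoidHom (fun _ : Fin d => ℤ) k))
    (fun γ hγ => by
      rw [AddMonoidHom.mem_ker]
      simpa using (ZMod.intCast_zmod_eq_zero_iff_dvd _ _).2 (hdiv γ hγ))

/-- The reflection on classes. -/
theorem reflect_mk (hΓ : Γ ≤ Γ.comap (negHom d k)) (x : Fin d → ℤ) :
    reflect hΓ (x : (Fin d → ℤ) ⧸ Γ) = ((negHom d k x : Fin d → ℤ) : (Fin d → ℤ) ⧸ Γ) := rfl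

/-- The coordinate on classes. -/
theorem coord_mk (hdiv : ∀ γ ∈ Γ, ((2 * Q : ℕ) : ℤ) ∣ γ k) (x : Fin d → ℤ) :
    coord Q hdiv (x : (Fin d → ℤ) ⧸ Γ) = ((x k : ℤ) : ZMod (2 * Q)) := rfl

/-- **Sufficiency: the box carries the site frame `(reflect, coord)` along `k`** as soon as
`Q ≥ 2`, `2Q e_k ∈ Γ` and `Γ ⊆ {2Q ∣ x_k}`. The layers `x_k ≡ 0, Q (mod 2Q)` are pointwise fixed
because `x - (x_k ↦ -x_k) x = 2x_k e_k` is a multiple of the period `2Q e_k` when `Q ∣ x_k`. -/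
theorem isSiteFrame (hQ : 2 ≤ Q) (hmem : (2 * Q) • (Pi.single k (1 : ℤ) : Fin d → ℤ) ∈ Γ)
    (hdiv : ∀ γ ∈ Γ, ((2 * Q : ℕ) : ℤ) ∣ γ k) :
    IsSiteFrame (unit Γ) k (reflect (le_comap_negHom hmem hdiv)) Q (coord Q hdiv) where
  two_le := hQ
  map_e_self := by
    rw [unit, reflect_mk, negHom_single, if_pos rfl, QuotientAddGroup.mk_neg]
  map_e_other l hl := by
    rw [unit, reflect_mk, negHom_single, if_neg hl]
  invol q := by
    induction q using QuotientAddGroup.induction_on with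
    | H x =>
      rw [reflect_mk, reflect_mk]
      congr 1
      funext m
      simp only [negHom_apply]
      split_ifs <;> simp
  height_self := by rw [unit, coord_mk, Pi.single_eq_same, Int.cast_one]
  height_other l hl := by rw [unit, coord_mk, Pi.single_eq_of_ne (Ne.symm hl), Int.cast_zero]
  height_map q := by
    induction q using QuotientAddGroup.induction_on with
    | H x => rw [reflect_mk, coord_mk, coord_mk, negHom_apply, if_pos rfl, Int.cast_neg]
  fix_of_layer q hq := by
    induction q using QuotientAddGroup.induction_on with
    | H x =>
      rw [coord_mk] at hq
      rw [reflect_mk, QuotientAddGroup.eq, negHom_eq_sub, neg_sub, sub_add_cancel]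
      -- `Q ∣ x_k`
      have hdvd : (Q : ℤ) ∣ x k := by
        rcases hq with h | h
        · have h' := (ZMod.intCast_zmod_eq_zero_iff_dvd _ _).1 h
          exact (Dvd.intro 2 (by push_cast; ring) : (Q : ℤ) ∣ ((2 * Q : ℕ) : ℤ)).trans h'
        · have h' : (((x k - Q : ℤ)) : ZMod (2 * Q)) = 0 := by
            push_cast at h ⊢
            rw [h, sub_self]
          have h'' := (ZMod.intCast_zmod_eq_zero_iff_dvd _ _).1 h'
          have h3 : (Q : ℤ) ∣ x k - Q :=
            (Dvd.intro 2 (by push_cast; ring) : (Q : ℤ) ∣ ((2 * Q : ℕ) : ℤ)).trans h''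
          simpa using h3.add (dvd_refl (Q : ℤ))
      obtain ⟨c, hc⟩ := hdvd
      rw [hc, show 2 * ((Q : ℤ) * c) = ((2 * Q : ℕ) : ℤ) * c by push_cast; ring]
      exact mul_zsmul_mem hmem c

/-- **CLASSIFICATION OF THE PERIODIC BOXES CARRYING A SITE FRAME.** `ℤ^d / Γ` carries a site frame
along the axis `k` with half period `Q` — for some reflection and some height — if and only if
`Q ≥ 2`, `2Q e_k ∈ Γ` and every period has `k`-th coordinate divisible by `2Q`
(`Γ = (Γ ∩ {x_k = 0}) ⊕ ℤ · 2Q e_k`). Instances: the cubic torus of even side `2Q ≥ 4` along every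
axis; the tilted box along every `k ∉ {i, j}` with `L = 2Q` (`isSiteFrame_tiltedBox`); NOT the
tilted box along `i` or `j` (`TiltedFrameNoGo.lean`), not a torus of odd side. -/
theorem exists_isSiteFrame_iff (Γ : AddSubgroup (Fin d → ℤ)) (k : Fin d) (Q : ℕ) :
    (∃ (σ : (Fin d → ℤ) ⧸ Γ →+ (Fin d → ℤ) ⧸ Γ) (h : (Fin d → ℤ) ⧸ Γ →+ ZMod (2 * Q)),
        IsSiteFrame (unit Γ) k σ Q h) ↔
      2 ≤ Q ∧ (2 * Q) • (Pi.single k (1 : ℤ) : Fin d → ℤ) ∈ Γ ∧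
        ∀ γ ∈ Γ, ((2 * Q : ℕ) : ℤ) ∣ γ k := by
  constructor
  · rintro ⟨σ, h, hS⟩
    exact ⟨hS.two_le, nsmul_single_mem_of_isSiteFrame hS, fun γ hγ => dvd_coord_of_isSiteFrame hS hγ⟩
  · rintro ⟨hQ, hmem, hdiv⟩
    exact ⟨_, _, isSiteFrame hQ hmem hdiv⟩

/-- **Uniqueness, explicitly**: every site frame on a periodic box IS the Fröhlich–Israel–Lieb–Simon
one — its reflection is `[x] ↦ [x_k ↦ -x_k]` and its height is `[x] ↦ x_k mod 2Q`. -/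
theorem _root_.Summit.QuantumFields.GaugeBoot.TiltedRP.IsSiteFrame.eq_reflect_coord
    {σ : (Fin d → ℤ) ⧸ Γ →+ (Fin d → ℤ) ⧸ Γ} {h : (Fin d → ℤ) ⧸ Γ →+ ZMod (2 * Q)}
    (hS : IsSiteFrame (unit Γ) k σ Q h) :
    σ = reflect (le_comap_negHom (nsmul_single_mem_of_isSiteFrame hS)
      (fun _ hγ => dvd_coord_of_isSiteFrame hS hγ)) ∧
      h = coord Q (fun _ hγ => dvd_coord_of_isSiteFrame hS hγ) := by
  have hS' := isSiteFrame hS.two_le (nsmul_single_mem_of_isSiteFrame hS)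
    (fun _ hγ => dvd_coord_of_isSiteFrame hS hγ)
  refine ⟨addMonoidHom_ext Γ fun m => ?_, addMonoidHom_ext Γ fun m => ?_⟩
  · by_cases hm : m = k
    · subst hm
      rw [hS.map_e_self, hS'.map_e_self]
    · rw [hS.map_e_other m hm, hS'.map_e_other m hm]
  · by_cases hm : m = k
    · subst hm
      rw [hS.height_self, hS'.height_self]
    · rw [hS.height_other m hm, hS'.height_other m hm]

end Site

end PeriodicBox

end TiltedRP

end Summit.QuantumFields.GaugeBoot
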